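import Mathlib.LinearAlgebra.Span.Basic
import Mathlib.Algebra.Module.Prod
import Mathlib.Algebra.Module.Pi
import Mathlib.Algebra.Field.ZMod
import Mathlib.Algebra.CharP.Two
import Mathlib.Algebra.BigOperators.Pi
import Mathlib.Algebra.BigOperators.Ring.Finset
import Mathlib.Algebra.Group.Pi.Lemmas
import Mathlib.Logic.Equiv.Fin.Basic
import Mathlib.Tactic.Ring
import Mathlib.Tactic.LinearCombination
import HarnessLib

/-!
# Route ConvexRankGates, crux `Capture` (stmt-PneNP-2659), line `csp-spine-meet-to-join` rev 4,
# Stub Q: degree-2 division by affine forms over `𝔽₂` (`stub_quadDivision : AffineComb → QuadDivision`)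
-/

namespace Summit.PneNP.PneNP.Cruxes.Capture.CspSpineMeetToJoin

set_option linter.dupNamespace false -- `Summit.PneNP.PneNP.…`: summit = sub-problem (D-0017)

/-- Evaluation of quadratic data is additive in the data. [folklore] -/
theorem qd_eval_add {ι : Type} [Fintype ι] (p q : ZMod 2 × (ι → ZMod 2) × (ι × ι → ZMod 2))
    (x : ι → ZMod 2) :
    (p + q).1 + ∑ i, (p + q).2.1 i * x i + ∑ i, ∑ j, (p + q).2.2 (i, j) * (x i * x j) =
      (p.1 + ∑ i, p.2.1 i * x i + ∑ i, ∑ j, p.2.2 (i, j) * (x i * x j)) +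
        (q.1 + ∑ i, q.2.1 i * x i + ∑ i, ∑ j, q.2.2 (i, j) * (x i * x j)) := by
  simp only [Prod.fst_add, Prod.snd_add, Pi.add_apply, add_mul, Finset.sum_add_distrib]
  ring

/-- Evaluation of quadratic data is homogeneous in the data. [folklore] -/
theorem qd_eval_smul {ι : Type} [Fintype ι] (c : ZMod 2)
    (p : ZMod 2 × (ι → ZMod 2) × (ι × ι → ZMod 2)) (x : ι → ZMod 2) :
    (c • p).1 + ∑ i, (c • p).2.1 i * x i + ∑ i, ∑ j, (c • p).2.2 (i, j) * (x i * x j) =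
      c * (p.1 + ∑ i, p.2.1 i * x i + ∑ i, ∑ j, p.2.2 (i, j) * (x i * x j)) := by
  simp only [Prod.smul_fst, Prod.smul_snd, Pi.smul_apply, smul_eq_mul, mul_add, Finset.mul_sum,
    mul_assoc]

/-- Quadratic data evaluated at a translate `z + t`: the difference is affine in `z`. [folklore] -/
theorem qd_eval_translate {ι : Type} [Fintype ι]
    (p : ZMod 2 × (ι → ZMod 2) × (ι × ι → ZMod 2)) (z t : ι → ZMod 2) :
    p.1 + ∑ i, p.2.1 i * (z + t) i + ∑ i, ∑ j, p.2.2 (i, j) * ((z + t) i * (z + t) j) =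
      (p.1 + ∑ i, p.2.1 i * z i + ∑ i, ∑ j, p.2.2 (i, j) * (z i * z j)) +
        ((∑ i, p.2.1 i * t i + ∑ i, ∑ j, p.2.2 (i, j) * (t i * t j)) +
          ∑ k, (∑ j, p.2.2 (k, j) * t j + ∑ j, p.2.2 (j, k) * t j) * z k) := by
  have hswap : ∑ i, ∑ j, p.2.2 (i, j) * (t i * z j) = ∑ k, ∑ j, p.2.2 (j, k) * (t j * z k) :=
    Finset.sum_comm
  simp only [Pi.add_apply, mul_add, add_mul, Finset.sum_add_distrib, Finset.sum_mul] at hswap ⊢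
  rw [hswap]
  have h1 : ∑ i, ∑ j, p.2.2 (i, j) * (z i * t j) = ∑ i, ∑ j, p.2.2 (i, j) * t j * z i := by
    refine Finset.sum_congr rfl fun i _ => Finset.sum_congr rfl fun j _ => by ring
  have h2 : ∑ k, ∑ j, p.2.2 (j, k) * (t j * z k) = ∑ k, ∑ j, p.2.2 (j, k) * t j * z k := by
    refine Finset.sum_congr rfl fun i _ => Finset.sum_congr rfl fun j _ => by ring
  rw [h1, h2]
  ring

/-- Affine data evaluated at `z + (x₀ - y)`. [folklore] -/
theorem qd_affine_translate {ι : Type} [Fintype ι] (f : ZMod 2 × (ι → ZMod 2))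
    (z x₀ y : ι → ZMod 2) :
    f.1 + ∑ i, f.2 i * (z + (x₀ - y)) i =
      (f.1 + ∑ i, f.2 i * z i) + (f.1 + ∑ i, f.2 i * x₀ i) - (f.1 + ∑ i, f.2 i * y i) := by
  simp only [Pi.add_apply, Pi.sub_apply, mul_add, mul_sub, Finset.sum_add_distrib,
    Finset.sum_sub_distrib]
  ring

/-- Zero-function data: quadratic data over `𝔽₂` vanishing at EVERY point of `𝔽₂^ι` lie in any submodule
containing the Boolean relations `Xᵢ + Xᵢ²` and the symmetry relations `XᵢXⱼ + XⱼXᵢ`: evaluating at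
`0`, `δᵢ`, `δᵢ + δⱼ` gives `p₀ = 0`, `p₂ (i,i) = p₁ i`, `p₂ (i,j) = p₂ (j,i)`; an enumeration of `ι`
breaks the symmetry to write the off-diagonal part as a combination of symmetry relations. [folklore] -/
theorem qd_zero_function {ι : Type} [Fintype ι] [DecidableEq ι]
    (p : ZMod 2 × (ι → ZMod 2) × (ι × ι → ZMod 2))
    (hp : ∀ x : ι → ZMod 2, p.1 + ∑ i, p.2.1 i * x i + ∑ i, ∑ j, p.2.2 (i, j) * (x i * x j) = 0)
    (M : Submodule (ZMod 2) (ZMod 2 × (ι → ZMod 2) × (ι × ι → ZMod 2)))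
    (h3 : ∀ i : ι, ((0 : ZMod 2), Pi.single i (1 : ZMod 2), Pi.single (i, i) (1 : ZMod 2)) ∈ M)
    (h4 : ∀ ij : ι × ι, ((0 : ZMod 2), (0 : ι → ZMod 2),
      Pi.single ij (1 : ZMod 2) + Pi.single (ij.2, ij.1) (1 : ZMod 2)) ∈ M) :
    p ∈ M := by
  have h0 : p.1 = 0 := by simpa using hp 0
  have h1 : ∀ i, p.2.1 i + p.2.2 (i, i) = 0 := by
    intro i
    simpa only [Pi.single_apply, mul_ite, mul_one, mul_zero, Finset.sum_ite_eq', Finset.mem_univ,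
      if_true, h0, zero_add] using hp (Pi.single i 1)
  have h2 : ∀ i j, i ≠ j → p.2.2 (i, j) + p.2.2 (j, i) = 0 := by
    intro i j hij
    have := hp (Pi.single i 1 + Pi.single j 1)
    simp only [Pi.add_apply, Pi.single_apply, mul_add, mul_ite, mul_one, mul_zero,
      Finset.sum_add_distrib, Finset.sum_ite_eq', Finset.mem_univ, if_true, h0, zero_add] at this
    linear_combination this - h1 i - h1 j
  -- an enumeration of `ι` breaks the symmetry between `(a, b)` and `(b, a)`
  let f := Fintype.equivFin ι
  let c : ι × ι → ZMod 2 := fun ij => if f ij.1 < f ij.2 then p.2.2 ij else 0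
  have hdec : p = ∑ i, p.2.1 i • ((0 : ZMod 2), Pi.single i (1 : ZMod 2), Pi.single (i, i) (1 : ZMod 2))
      + ∑ ij, c ij • ((0 : ZMod 2), (0 : ι → ZMod 2),
          Pi.single ij (1 : ZMod 2) + Pi.single (ij.2, ij.1) (1 : ZMod 2)) := by
    refine Prod.ext ?_ (Prod.ext (funext fun k => ?_) (funext fun ab => ?_))
    · simp [Prod.fst_sum, h0]
    · simp [Prod.fst_sum, Prod.snd_sum, Finset.sum_apply, Pi.single_apply]
    · obtain ⟨a, b⟩ := ab
      simp only [Prod.snd_add, Prod.snd_sum, Finset.sum_apply, Prod.smul_snd, Pi.smul_apply,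
        Pi.add_apply, Pi.single_apply, smul_eq_mul, mul_add, mul_ite, mul_one, mul_zero,
        Fintype.sum_prod_type, ite_and, Prod.mk.injEq, Finset.sum_add_distrib, Finset.sum_ite_irrel,
        Finset.sum_const_zero, Finset.sum_ite_eq, Finset.mem_univ, if_true]
      by_cases hab : a = b
      · subst hab
        simpa [c] using (CharTwo.add_eq_zero.mp (h1 a)).symm
      · have hne : f a ≠ f b := fun h => hab (f.injective h)
        rcases lt_or_gt_of_ne hne with h | h
        · simp [c, h, not_lt_of_gt h, Ne.symm hab]
        · simpa [c, h, not_lt_of_gt h, Ne.symm hab] using CharTwo.add_eq_zero.mp (h2 a b hab)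
  rw [hdec]
  exact M.add_mem (M.sum_mem fun i _ => M.smul_mem _ (h3 i)) (M.sum_mem fun ij _ => M.smul_mem _ (h4 ij))

/-- **Degree-2 division by affine forms over `𝔽₂`** (`AffineComb → QuadDivision`, Stub Q of the line).
Quadratic data `p = (p₀, p₁, p₂)` stand for `p₀ + ∑ᵢ p₁ i Xᵢ + ∑_{i,j} p₂ (i,j) XᵢXⱼ`, affine data
`e v = (e₀, e₁)` for `e₀ + ∑ᵢ e₁ i Xᵢ`.  If the forms `e v` have a common zero and `p` vanishes at
every common zero, then `p` lies in the `𝔽₂`-span of the forms, their multiples `Xᵢ · e v`, the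
Boolean relations `Xᵢ + Xᵢ²` and the symmetry relations `XᵢXⱼ + XⱼXᵢ`.
Proof: induction on the finite set `F` of imposed forms.  `F = ∅`: `p` is a zero-function datum
(`qd_zero_function`).  `F = insert v F'`: if `e v` vanishes on the zero set `S'` of `F'`, recurse;
otherwise pick `y ∈ S'` with `e v (y) = 1` and a common zero `x₀`, put `t = x₀ - y`; the translate
`z ↦ z + t` maps `S' ∩ {e v = 1}` into the common zero set, and `p (z + t) - p z = a z` is AFFINE in
`z` (`qd_eval_translate`), so `p - a · (e v)` vanishes on all of `S'` (as `𝔽₂ = {0, 1}`) and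
`a · (e v) = a₀ (e v) + ∑ₖ a₁ k (Xₖ · e v)` is in the span; recurse.  The hypothesis `AffineComb`
is not needed. [folklore] -/
theorem stub_quadDivision :
    (∀ (ι V : Type) [Fintype ι] [Fintype V]
      (e : V → ZMod 2 × (ι → ZMod 2)) (q : ZMod 2 × (ι → ZMod 2)),
      (∃ x : ι → ZMod 2, ∀ v, (e v).1 + ∑ i, (e v).2 i * x i = 0) →
      (∀ x : ι → ZMod 2, (∀ v, (e v).1 + ∑ i, (e v).2 i * x i = 0) → q.1 + ∑ i, q.2 i * x i = 0) →
      ∃ cf : V → ZMod 2, q = ∑ v, cf v • e v) →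
    (∀ (ι V : Type) [Fintype ι] [DecidableEq ι] [Fintype V]
      (e : V → ZMod 2 × (ι → ZMod 2)) (p : ZMod 2 × (ι → ZMod 2) × (ι × ι → ZMod 2)),
      (∃ x : ι → ZMod 2, ∀ v, (e v).1 + ∑ i, (e v).2 i * x i = 0) →
      (∀ x : ι → ZMod 2, (∀ v, (e v).1 + ∑ i, (e v).2 i * x i = 0) →
        p.1 + ∑ i, p.2.1 i * x i + ∑ i, ∑ j, p.2.2 (i, j) * (x i * x j) = 0) →
      p ∈ Submodule.span (ZMod 2)
        (Set.range (fun v : V => ((e v).1, (e v).2, (0 : ι × ι → ZMod 2))) ∪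
         Set.range (fun vi : V × ι => ((0 : ZMod 2), Pi.single vi.2 (e vi.1).1,
            fun ab : ι × ι => if ab.1 = vi.2 then (e vi.1).2 ab.2 else 0)) ∪
         Set.range (fun i : ι => ((0 : ZMod 2), Pi.single i (1 : ZMod 2), Pi.single (i, i) (1 : ZMod 2))) ∪
         Set.range (fun ij : ι × ι => ((0 : ZMod 2), (0 : ι → ZMod 2),
            Pi.single ij (1 : ZMod 2) + Pi.single (ij.2, ij.1) (1 : ZMod 2))))) := by
  intro _ ι V _ _ _ e p hS hp
  classical
  -- the evaluation functionals `L x : data ↦ value of the represented polynomial at x`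
  obtain ⟨L, hL⟩ : ∃ L : (ι → ZMod 2) →
      ((ZMod 2 × (ι → ZMod 2) × (ι × ι → ZMod 2)) →ₗ[ZMod 2] ZMod 2),
      ∀ x q, L x q = q.1 + ∑ i, q.2.1 i * x i + ∑ i, ∑ j, q.2.2 (i, j) * (x i * x j) :=
    ⟨fun x =>
      { toFun := fun q => q.1 + ∑ i, q.2.1 i * x i + ∑ i, ∑ j, q.2.2 (i, j) * (x i * x j)
        map_add' := fun q r => qd_eval_add q r x
        map_smul' := fun c q => qd_eval_smul c q x }, fun _ _ => rfl⟩
  -- induction on the finite set `F` of imposed forms, for any submodule `M` containing the generators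
  suffices key : ∀ M : Submodule (ZMod 2) (ZMod 2 × (ι → ZMod 2) × (ι × ι → ZMod 2)),
      (∀ v, ((e v).1, (e v).2, (0 : ι × ι → ZMod 2)) ∈ M) →
      (∀ v k, ((0 : ZMod 2), Pi.single k (e v).1,
        fun ab : ι × ι => if ab.1 = k then (e v).2 ab.2 else 0) ∈ M) →
      (∀ i : ι, ((0 : ZMod 2), Pi.single i (1 : ZMod 2), Pi.single (i, i) (1 : ZMod 2)) ∈ M) →
      (∀ ij : ι × ι, ((0 : ZMod 2), (0 : ι → ZMod 2),
        Pi.single ij (1 : ZMod 2) + Pi.single (ij.2, ij.1) (1 : ZMod 2)) ∈ M) →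
      ∀ (F : Finset V) (q : ZMod 2 × (ι → ZMod 2) × (ι × ι → ZMod 2)),
        (∃ x : ι → ZMod 2, ∀ v ∈ F, (e v).1 + ∑ i, (e v).2 i * x i = 0) →
        (∀ x : ι → ZMod 2, (∀ v ∈ F, (e v).1 + ∑ i, (e v).2 i * x i = 0) → L x q = 0) → q ∈ M by
    obtain ⟨x₀, hx₀⟩ := hS
    exact key _ (fun v => Submodule.subset_span (Or.inl (Or.inl (Or.inl ⟨v, rfl⟩))))
      (fun v k => Submodule.subset_span (Or.inl (Or.inl (Or.inr ⟨(v, k), rfl⟩))))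
      (fun i => Submodule.subset_span (Or.inl (Or.inr ⟨i, rfl⟩)))
      (fun ij => Submodule.subset_span (Or.inr ⟨ij, rfl⟩)) Finset.univ p ⟨x₀, fun v _ => hx₀ v⟩
      fun x hx => by rw [hL]; exact hp x fun v => hx v (Finset.mem_univ v)
  intro M hM1 hM2 hM3 hM4 F
  induction F using Finset.induction_on with
  | empty =>
    intro q _ hq
    refine qd_zero_function q (fun x => ?_) M hM3 hM4
    rw [← hL]
    exact hq x fun v hv => absurd hv (Finset.notMem_empty v)
  | insert v F hvF IH =>
    intro q hne hq
    obtain ⟨x₀, hx₀⟩ := hne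
    have hx₀F : ∀ w ∈ F, (e w).1 + ∑ i, (e w).2 i * x₀ i = 0 := fun w hw =>
      hx₀ w (Finset.mem_insert_of_mem hw)
    have hx₀v : (e v).1 + ∑ i, (e v).2 i * x₀ i = 0 := hx₀ v (Finset.mem_insert_self v F)
    by_cases hc : ∀ y : ι → ZMod 2, (∀ w ∈ F, (e w).1 + ∑ i, (e w).2 i * y i = 0) →
        (e v).1 + ∑ i, (e v).2 i * y i = 0
    · -- `e v` already vanishes on the zero set of `F`
      exact IH q ⟨x₀, hx₀F⟩ fun x hx => hq x ((Finset.forall_mem_insert v F _).2 ⟨hc x hx, hx⟩)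
    push Not at hc
    obtain ⟨y, hyF, hyv⟩ := hc
    have zmod2 : ∀ c : ZMod 2, c = 0 ∨ c = 1 := by decide
    have hyv1 : (e v).1 + ∑ i, (e v).2 i * y i = 1 := (zmod2 _).resolve_left hyv
    -- translation vector `t` and the affine correction `a = (a₀, a₁)` with `q (z + t) - q z = a z`
    set t : ι → ZMod 2 := x₀ - y with ht
    set a₀ : ZMod 2 := ∑ i, q.2.1 i * t i + ∑ i, ∑ j, q.2.2 (i, j) * (t i * t j) with ha₀
    set a₁ : ι → ZMod 2 := fun k => ∑ j, q.2.2 (k, j) * t j + ∑ j, q.2.2 (j, k) * t j with ha₁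
    have hL1 : ∀ z, L z ((e v).1, (e v).2, (0 : ι × ι → ZMod 2)) = (e v).1 + ∑ i, (e v).2 i * z i := by
      intro z
      rw [hL]
      simp
    have hL2 : ∀ z k, L z ((0 : ZMod 2), Pi.single k (e v).1,
        fun ab : ι × ι => if ab.1 = k then (e v).2 ab.2 else 0) =
        z k * ((e v).1 + ∑ i, (e v).2 i * z i) := by
      intro z k
      rw [hL]
      simp only [Pi.single_apply, ite_mul, zero_mul, Finset.sum_ite_irrel, Finset.sum_const_zero,
        Finset.sum_ite_eq', Finset.mem_univ, if_true, zero_add, mul_add, Finset.mul_sum]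
      rw [mul_comm]
      congr 1
      exact Finset.sum_congr rfl fun j _ => by ring
    -- `r` represents the product `a · (e v)`
    set r := a₀ • ((e v).1, (e v).2, (0 : ι × ι → ZMod 2)) + ∑ k, a₁ k • ((0 : ZMod 2),
      Pi.single k (e v).1, fun ab : ι × ι => if ab.1 = k then (e v).2 ab.2 else 0) with hr
    have hrM : r ∈ M := M.add_mem (M.smul_mem _ (hM1 v)) (M.sum_mem fun k _ => M.smul_mem _ (hM2 v k))
    have hLr : ∀ z, L z r = (a₀ + ∑ k, a₁ k * z k) * ((e v).1 + ∑ i, (e v).2 i * z i) := by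
      intro z
      rw [hr, map_add, map_smul, map_sum]
      simp_rw [map_smul, smul_eq_mul, hL1, hL2]
      conv_rhs => rw [add_mul, Finset.sum_mul]
      simp_rw [mul_assoc]
    -- `q - r` vanishes on the zero set of `F`
    have hq' : ∀ z, (∀ w ∈ F, (e w).1 + ∑ i, (e w).2 i * z i = 0) → L z (q - r) = 0 := by
      intro z hz
      rw [map_sub, hLr]
      rcases zmod2 ((e v).1 + ∑ i, (e v).2 i * z i) with h0 | h1
      · rw [h0, mul_zero, sub_zero]
        exact hq z ((Finset.forall_mem_insert v F _).2 ⟨h0, hz⟩)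
      · -- `z + t` is a common zero of `insert v F`
        have hzt : ∀ w ∈ insert v F, (e w).1 + ∑ i, (e w).2 i * (z + t) i = 0 := by
          intro w hw
          rw [ht, qd_affine_translate]
          rcases Finset.mem_insert.1 hw with rfl | hw
          · rw [h1, hx₀v, hyv1]; ring
          · rw [hz w hw, hx₀F w hw, hyF w hw]; ring
        have := hq (z + t) hzt
        rw [hL, qd_eval_translate] at this
        rw [h1, mul_one, CharTwo.sub_eq_add, hL]
        exact this
    rw [(sub_add_cancel q r).symm]
    exact M.add_mem (IH (q - r) ⟨x₀, hx₀F⟩ hq') hrM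

end Summit.PneNP.PneNP.Cruxes.Capture.CspSpineMeetToJoin
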